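import Mathlib
import Literature.Computability.AlgebraicComplexity.StandardFamilies
import Literature.Computability.AlgebraicComplexity.ArithCircuit
import Literature.Computability.Complexity.Circuit
import Literature.Computability.Complexity.MonotoneMatchingDepth
import Literature.Barriers.PneNP.MonotoneGap
import Summits.ValiantsHypothesis.ValiantsHypothesis.Theses.DivisionGap

/-!
# Sketch — crux-ideate round 2, ideator 5, crux `DivisionGap.PerCofactorDegreeReduction`
# (stmt-ValiantsHypothesis-15046).  First lemmas of the two idea cards, as elaborating signatures.

Card A `koenig-board-shrinking`: `CoverRung`, `CoverRungJS`, `LineSaturated`, `SaturatedCore`.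
Card B `scalar-semiring-balancing`: `ScalarBalancingShadow`, `DeficiencyDepthRung`, `FarPairReduction`.
Nothing here is proved; the statements only have to elaborate (role prompt, CRUX-IDEATE `First lemma`).
-/

namespace Summit.ValiantsHypothesis.ValiantsHypothesis.Cruxes.PerCofactorDegreeReduction.Ideator5

open Literature.Computability.AlgebraicComplexity MvPolynomial
open Literature.Computability.Complexity Literature.Barriers.PneNP
open Summit.ValiantsHypothesis.ValiantsHypothesis.Theses.DivisionGap (PerCofactorDegreeReduction)
open scoped NNReal

/-! ## Card A — Kőnig board shrinking -/

/-- **CoverRung** (first lemma of card A).  If ONE monomial `m` of the cofactor `h` is supported in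
the union of the rows `R` and the columns `C` (a line cover of its support), then the permanent of
order `n − |R| − |C|` is a free projection-and-bottom-slice of `per_n · h`:
`L(per_{n−|R|−|C|}) ≤ L(per_n · h) + 1`.  Proof sketch: substitute `x := 1` on the cover lines and
`x := 0` on the complementary board outside a `δ × δ` square `Q` (`δ = n − |R| − |C|`); then
`per_n ↦ |R|!·|C|!·per_Q` and `h ↦ h♮` with `h♮(0) ≥ h_m > 0`; the lowest total-degree component of the
product is `|R|!|C|! h♮(0) · per_Q` (free over `ℝ≥0`: `stub_bottomComponentFree`); unscale (one gate). -/
def CoverRung : Prop :=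
  ∀ (n : ℕ) (h : MvPolynomial (Fin n × Fin n) ℝ≥0) (m : (Fin n × Fin n) →₀ ℕ), m ∈ h.support →
    ∀ (R C : Finset (Fin n)), (∀ v ∈ m.support, v.1 ∈ R ∨ v.2 ∈ C) →
      complexity (perPoly (Fin (n - (R.card + C.card))) ℝ≥0) ≤
        complexity (perPoly (Fin n) ℝ≥0 * h) + 1

/-- **CoverRungJS**: the Jerrum–Snir closer of `CoverRung` (`js_le_two_mul_complexity_perPoly`):
a degree-free exponential lower bound `2^{n−|R|−|C|}` for `per_n · h` from one line-covered monomial. -/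
def CoverRungJS : Prop :=
  ∀ (n : ℕ) (h : MvPolynomial (Fin n × Fin n) ℝ≥0) (m : (Fin n × Fin n) →₀ ℕ), m ∈ h.support →
    ∀ (R C : Finset (Fin n)), (∀ v ∈ m.support, v.1 ∈ R ∨ v.2 ∈ C) → R.card + C.card < n →
      (n - (R.card + C.card)) * (2 ^ (n - (R.card + C.card) - 1) - 1) ≤
        2 * complexity (perPoly (Fin n) ℝ≥0 * h) + 4

/-- A cofactor is LINE-SATURATED at level `t` when every monomial needs more than `n − t` lines
(rows + columns) to cover its support — by Kőnig, every monomial's support graph has a matching of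
size `> n − t`.  `CoverRungJS` makes every cofactor of a size-`s` multiple line-saturated at level
`log₂ s + O(1)`; in the crux's window (`s < 2^{(n log n)^{1/k}}`) this is `t = n^{1/k + o(1)}`. -/
def LineSaturated (n t : ℕ) (h : MvPolynomial (Fin n × Fin n) ℝ≥0) : Prop :=
  ∀ m ∈ h.support, ∀ (R C : Finset (Fin n)), (∀ v ∈ m.support, v.1 ∈ R ∨ v.2 ∈ C) →
    n < R.card + C.card + t

/-- **SaturatedCore** — what is left of the crux after card A: degree reduction only for cofactors
that are line-saturated at level `log₂ L(per_n·h) + 4` (the level `CoverRungJS` certifies for free).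
`CoverRungJS → (SaturatedCore ↔ PerCofactorDegreeReduction)` is the composition a crux-plan would check. -/
def SaturatedCore : Prop :=
  ∃ k : ℕ, ∀ (n : ℕ) (h : MvPolynomial (Fin n × Fin n) ℝ≥0), h ≠ 0 →
    LineSaturated n (Nat.log 2 (complexity (perPoly (Fin n) ℝ≥0 * h)) + 4) h →
    ∃ h' : MvPolynomial (Fin n × Fin n) ℝ≥0, h' ≠ 0 ∧
      h'.totalDegree ≤ 2 ^ ((Nat.log 2 n + Nat.log 2 (complexity (perPoly (Fin n) ℝ≥0 * h)) + k) ^ k) ∧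
      complexity (perPoly (Fin n) ℝ≥0 * h') ≤
        2 ^ ((Nat.log 2 n + Nat.log 2 (complexity (perPoly (Fin n) ℝ≥0 * h)) + k) ^ k)

/-- The trivial direction of the composition: the crux implies its saturated core. -/
theorem saturatedCore_of_pcdr (h : PerCofactorDegreeReduction) : SaturatedCore := by
  obtain ⟨k, hk⟩ := h
  exact ⟨k, fun n h hh _ => hk n h hh⟩

/-! ## Card B — balancing over the scalar semiring `ℝ≥0[x_Z]` + Raz–Wigderson -/

/-- The `Z`-light `Y`-shadow of `g` (`Y = Zᶜ`): "some monomial of `g` of mass `≤ d` off `Z` has its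
off-`Z` support inside the input graph" — the Boolean function computed by the shadow of the
`K = ℝ≥0[x_Z]`-formula after `x_Z := 1`. -/
def lightShadow {n : ℕ} (g : MvPolynomial (Fin n × Fin n) ℝ≥0) (Z : Finset (Fin n × Fin n)) (d : ℕ)
    (x : Fin n × Fin n → Bool) : Bool :=
  decide (∃ μ ∈ g.support, (μ.sum fun v e => if v ∈ Z then 0 else e) ≤ d ∧
    ∀ v ∈ μ.support, v ∉ Z → x v = true)

/-- **ScalarBalancingShadow** (first lemma of card B).  Hyafil/VSBR/Brent balancing
(`formulaComplexity_le_two_pow`, any commutative semiring) applied over `K = ℝ≥0[x_Z]` — the heavy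
variables are SCALARS, so only the off-`Z` degree `d` enters — followed by the formula-level shadow
(`+ ↦ ∨`, `× ↦ ∧`, `K`-leaf `κ ↦ [κ ≠ 0]`, exact over `ℝ≥0`): the light shadow has monotone formula
size `≤ 2^{18 E²}` as soon as `2^E` dominates `(d+1)² · L(g) + n²` and `d`. -/
def ScalarBalancingShadow : Prop :=
  ∀ (n : ℕ) (g : MvPolynomial (Fin n × Fin n) ℝ≥0) (Z : Finset (Fin n × Fin n)) (d E : ℕ),
    1 ≤ E → (d + 1) ^ 2 * complexity g + n * n ≤ 2 ^ E → d < 2 ^ E →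
    formulaSizeOver monotoneBasis (lightShadow g Z d) ≤ 2 ^ (18 * E ^ 2)

/-- **DeficiencyDepthRung** (closer (i) of card B; the weaker twin of `CoverRungJS`): with `Z` = the
support of one monomial of `h`, `lightShadow (per_n·h) Z n = PM(· ∪ Z)`, which restricts (Kőnig cover
`(R, C)` of `Z`, cover lines `:= 1`, off-board `:= 0`) to `perfectMatchingFn (n − |R| − |C|)`; with the
named fact `RazWigderson1992_bpm_monotoneFormulaSize` this reads `c·(n − |R| − |C|) ≤ 18 E²`. -/
def DeficiencyDepthRung : Prop :=
  RazWigderson1992_bpm_monotoneFormulaSize →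
    ∃ c : ℝ, 0 < c ∧ ∃ n₀ : ℕ, ∀ (n : ℕ) (h : MvPolynomial (Fin n × Fin n) ℝ≥0)
      (m : (Fin n × Fin n) →₀ ℕ), m ∈ h.support →
      ∀ (R C : Finset (Fin n)), (∀ v ∈ m.support, v.1 ∈ R ∨ v.2 ∈ C) → n₀ + R.card + C.card ≤ n →
      ∀ E : ℕ, 1 ≤ E → (n + 1) ^ 2 * complexity (perPoly (Fin n) ℝ≥0 * h) + n * n ≤ 2 ^ E →
        c * (n - (R.card + C.card) : ℕ) ≤ 18 * (E : ℝ) ^ 2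

/-- **FarPairReduction** (closer (ii) of card B, the planting step): "contains two perfect matchings at
Hamming distance `≥ m`" on the `2m`-board is at least as hard for monotone formulas as bipartite
perfect matching on the `m`-board (plant `G ⊕ C_{2m}`: a Hamiltonian-cycle block supplies the far
partner).  This is what makes the shadow of `per_n · h_far` (the sibling residual's first member)
Raz–Wigderson-hard although `h_far` is saturated, aligned and pure-poor. -/
def FarPairReduction : Prop :=
  ∀ m : ℕ, 1 ≤ m →
    formulaSizeOver monotoneBasis (perfectMatchingFn m) ≤
      formulaSizeOver monotoneBasis (fun x : Fin (2 * m) × Fin (2 * m) → Bool =>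
        decide (∃ π ρ : Equiv.Perm (Fin (2 * m)), (∀ i, x (i, π i) = true) ∧ (∀ i, x (i, ρ i) = true) ∧
          m ≤ (Finset.univ.filter fun i => π i ≠ ρ i).card))

end Summit.ValiantsHypothesis.ValiantsHypothesis.Cruxes.PerCofactorDegreeReduction.Ideator5
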